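import Summits.NavierStokesRegularity.NavierStokesRegularity.Theorems.GaldiLiouvilleGateRecordZoomAncientOfKernel
import HarnessLib

/-!
# Route `GaldiLiouvilleGate`, crux `RecordZoomAncient` (stmt-NavierStokesRegularity-0894), line `registered` —
  the r8 kernel is WEAKER than the r7 kernel (monotonicity of the reshapes)

Lead `prover-line-stmt-NavierStokesRegularity-0894-c4-0`, 2026-08-17. One theorem:
`noVelocityBump_of_noOscillationBump : (5'') → (5)` for a fixed solution — whence `K7 → K8` propositionally, where
`K7` is the r7 kernel `stub_diffuseFaintKernel`
("faint ∧ (5) no persistent isolated critical bump ⇒ False"; a bump = near-maximal velocity `‖u(tc n, xc n)‖ ≥ θ M n`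
at its centre + bounded local enstrophy + bounded local `L⁶` mass in velocity units) and `K8` the r8 kernel
`stub_oscillationKernel` ("faint ∧ (5'') no persistent critical OSCILLATION bump with bounded local enstrophy history
⇒ False"), both verbatim as registered on the crux (`Cruxes/RecordZoomAncient/Lines/birth.lean`, r7 @eb4141d8 and r8).
So whoever proves `K8`'s content proves `K7`'s, and `Z` follows from either (`recordZoomAncient_of_diffuseFaintKernel`
p163700, `recordZoomAncient_of_oscillationKernel` p166059).

**Proof.** Given (5'') (no oscillation bump) we show (5) (no velocity bump). Suppose a velocity bump
`(tc, xc, M, θ, D, D₆)`. Choose `R₀ ≥ 1` with `(θ/2)⁶ R₀³ |B(0,1)| > D₆`. By the local `L⁶` bound at `t = tc n`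
(eventually in `n`, radius `R₀`), the ball `B(xc n, R₀ν/M n)` contains a point `x₂ n` with
`‖u(tc n, x₂ n)‖ ≤ θ M n/2` (otherwise `∫_B ‖u‖⁶ > (θM/2)⁶|B| ≥ D₆(νM)³`); then `‖u(tc n, xc n) − u(tc n, x₂ n)‖ ≥ θM n/2`
and `‖xc n − x₂ n‖ ≤ R₀ν/M n`: along the tail `n ≥ N` this is an oscillation bump with constant `θ/2` (the enstrophy
bound around `xc n` is the same datum), contradicting (5'').
-/

noncomputable section

open Set MeasureTheory Filter Topology Function
open scoped ENNReal NNReal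
open Literature.Analysis.FluidPDE

namespace Summit.NavierStokesRegularity.NavierStokesRegularity.Theorems.RecordZoomAncient.Birth

-- the problem-side namespace `Summit.NavierStokesRegularity.NavierStokesRegularity.…` (summit =
-- problem for this single-problem summit) duplicates `NavierStokesRegularity` by design
set_option linter.dupNamespace false

/-- **No oscillation bump ⇒ no velocity bump** (so the r8 kernel `stub_oscillationKernel` is implied by — weaker
than — the r7 kernel `stub_diffuseFaintKernel`; hypotheses (5'') and (5) verbatim, for a fixed `ν`, `T`, `u`).
A velocity bump with bounded local `L⁶` mass contains, within `R₀(θ, D₆)` velocity radii of its centre, a point of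
velocity `≤ θM/2`, hence a `θ/2`-oscillation pair along a tail of the sequence; see the module docstring. -/
theorem noVelocityBump_of_noOscillationBump :
    ∀ (ν T : ℝ), 0 < ν → ∀ (u : ℝ → EuclideanSpace ℝ (Fin 3) → EuclideanSpace ℝ (Fin 3)), (∀ (tc : ℕ → ℝ) (x₁
      x₂ : ℕ → EuclideanSpace ℝ (Fin 3)) (M : ℕ → ℝ) (θ R₀ D : ℝ), (∀ n, 0 < tc n ∧ tc n < T) → (∀ n, 0 < M n)
      → (∀ n, ∀ t ∈ Set.Icc 0 (tc n), ∀ x, ‖u t x‖ ≤ M n) → Filter.Tendsto (fun n => tc n * M n ^ 2)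
      Filter.atTop Filter.atTop → 0 < θ → 0 < R₀ → (∀ n, ‖x₁ n - x₂ n‖ ≤ R₀ * (ν / M n)) → (∀ n, θ * M n ≤ ‖u
      (tc n) (x₁ n) - u (tc n) (x₂ n)‖) → (∀ R S : ℝ, 0 < R → 0 < S → ∀ᶠ n in Filter.atTop, ∀ t ∈ Set.Icc 0 (tc
      n), tc n - S * (ν / M n ^ 2) ≤ t → (∫⁻ y in Metric.ball (x₁ n) (R * (ν / M n)), ENNReal.ofReal
      (frobeniusNormSq (fderiv ℝ (u t) y))) ≤ ENNReal.ofReal (D * (ν * M n))) → False) → (∀ (tc : ℕ → ℝ) (xc :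
      ℕ → EuclideanSpace ℝ (Fin 3)) (M : ℕ → ℝ) (θ D D₆ : ℝ), (∀ n, 0 < tc n ∧ tc n < T) → (∀ n, 0 < M n) → (∀
      n, ∀ t ∈ Set.Icc 0 (tc n), ∀ x, ‖u t x‖ ≤ M n) → Filter.Tendsto (fun n => tc n * M n ^ 2) Filter.atTop
      Filter.atTop → 0 < θ → (∀ n, θ * M n ≤ ‖u (tc n) (xc n)‖) → (∀ R S : ℝ, 0 < R → 0 < S → ∀ᶠ n in
      Filter.atTop, ∀ t ∈ Set.Icc 0 (tc n), tc n - S * (ν / M n ^ 2) ≤ t → (∫⁻ y in Metric.ball (xc n) (R * (ν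
      / M n)), ENNReal.ofReal (frobeniusNormSq (fderiv ℝ (u t) y))) ≤ ENNReal.ofReal (D * (ν * M n))) → (∀ R S
      : ℝ, 0 < R → 0 < S → ∀ᶠ n in Filter.atTop, ∀ t ∈ Set.Icc 0 (tc n), tc n - S * (ν / M n ^ 2) ≤ t → (∫⁻ y
      in Metric.ball (xc n) (R * (ν / M n)), ‖u t y‖ₑ ^ (6 : ℕ)) ≤ ENNReal.ofReal (D₆ * (ν * M n) ^ 3)) →
      False) := by
  intro ν T hν u h5 tc xc M θ D D₆ htc hM hdomV hpast hθ hvel hE h6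
  -- ### the radius `R₀`
  set V₁ : ℝ≥0∞ := volume (Metric.ball (0 : EuclideanSpace ℝ (Fin 3)) 1) with hV₁def
  have hV₁pos : 0 < V₁ := Metric.measure_ball_pos volume _ one_pos
  have hV₁top : V₁ < ∞ := measure_ball_lt_top
  have hV₁r : 0 < V₁.toReal := ENNReal.toReal_pos hV₁pos.ne' hV₁top.ne
  set R₀ : ℝ := max 1 ((|D₆| + 1) * 64 / (θ ^ 6 * V₁.toReal)) with hR₀def
  have hR₀1 : 1 ≤ R₀ := le_max_left _ _
  have hR₀ : 0 < R₀ := one_pos.trans_le hR₀1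
  have hkey : D₆ < (θ / 2) ^ 6 * R₀ ^ 3 * V₁.toReal := by
    have h1 : (|D₆| + 1) * 64 / (θ ^ 6 * V₁.toReal) ≤ R₀ := le_max_right _ _
    have h2 : R₀ ≤ R₀ ^ 3 := by
      calc R₀ = R₀ * 1 * 1 := by ring
        _ ≤ R₀ * R₀ * R₀ := by gcongr
        _ = R₀ ^ 3 := by ring
    have hθ6 : 0 < θ ^ 6 := by positivity
    rw [div_le_iff₀ (mul_pos hθ6 hV₁r)] at h1
    have h3 : D₆ < (|D₆| + 1) := (le_abs_self _).trans_lt (lt_add_one _)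
    have h4 : (|D₆| + 1) * 64 ≤ R₀ ^ 3 * (θ ^ 6 * V₁.toReal) :=
      h1.trans (mul_le_mul_of_nonneg_right h2 (mul_pos hθ6 hV₁r).le)
    nlinarith [mul_pos hθ6 hV₁r]
  -- ### eventually: a point of small velocity in the ball of `R₀` velocity radii
  have hev : ∀ᶠ n in atTop, ∃ x₂ ∈ Metric.ball (xc n) (R₀ * (ν / M n)), ‖u (tc n) x₂‖ ≤ θ / 2 * M n := by
    filter_upwards [h6 R₀ 1 hR₀ one_pos] with n hn
    by_contra hne
    push Not at hne
    have hball := hn (tc n) ⟨(htc n).1.le, le_rfl⟩ (by nlinarith [div_pos hν (pow_pos (hM n) 2)])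
    -- lower bound of the `L⁶` mass
    have hM6 : 0 < M n := hM n
    have hr : 0 < R₀ * (ν / M n) := mul_pos hR₀ (div_pos hν (hM n))
    have hvol : volume (Metric.ball (xc n) (R₀ * (ν / M n))) = ENNReal.ofReal ((R₀ * (ν / M n)) ^ 3) * V₁ := by
      rw [hV₁def, Measure.addHaar_ball volume (xc n) hr.le, finrank_euclideanSpace_fin]
    have hlow : ENNReal.ofReal ((θ / 2 * M n) ^ 6) * volume (Metric.ball (xc n) (R₀ * (ν / M n))) ≤
        ∫⁻ y in Metric.ball (xc n) (R₀ * (ν / M n)), ‖u (tc n) y‖ₑ ^ (6 : ℕ) := by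
      rw [← setLIntegral_const]
      refine setLIntegral_mono' measurableSet_ball fun y hy => ?_
      rw [← ofReal_norm, ← ENNReal.ofReal_pow (norm_nonneg _)]
      exact ENNReal.ofReal_le_ofReal (pow_le_pow_left₀ (by positivity) (hne y hy).le 6)
    have hlt : ENNReal.ofReal (D₆ * (ν * M n) ^ 3) <
        ENNReal.ofReal ((θ / 2 * M n) ^ 6) * volume (Metric.ball (xc n) (R₀ * (ν / M n))) := by
      rw [hvol, ← mul_assoc, ← ENNReal.ofReal_mul (by positivity), ← ENNReal.ofReal_toReal hV₁top.ne,
        ← ENNReal.ofReal_mul (by positivity), ENNReal.ofReal_lt_ofReal_iff (by positivity)]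
      have heq : (θ / 2 * M n) ^ 6 * (R₀ * (ν / M n)) ^ 3 * V₁.toReal =
          ((θ / 2) ^ 6 * R₀ ^ 3 * V₁.toReal) * (ν * M n) ^ 3 := by
        field_simp
      rw [heq]
      exact mul_lt_mul_of_pos_right hkey (by positivity)
    exact absurd (hlow.trans hball) (not_le.2 hlt)
  obtain ⟨N, hN⟩ := eventually_atTop.1 hev
  choose! x₂' hx₂' using fun n (hn : N ≤ n) => hN n hn
  -- ### the tail data of an oscillation bump with constant `θ/2`
  refine h5 (fun k => tc (k + N)) (fun k => xc (k + N)) (fun k => x₂' (k + N)) (fun k => M (k + N)) (θ / 2) R₀ D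
    (fun k => htc _) (fun k => hM _) (fun k => hdomV _) (hpast.comp (tendsto_add_atTop_nat N)) (by positivity) hR₀
    (fun k => ?_) (fun k => ?_) (fun R S hR hS => (tendsto_add_atTop_nat N).eventually (hE R S hR hS))
  · -- distance
    have h := (hx₂' (k + N) (Nat.le_add_left N k)).1
    rw [Metric.mem_ball, dist_comm, dist_eq_norm] at h
    exact h.le
  · -- oscillation
    have hsmall := (hx₂' (k + N) (Nat.le_add_left N k)).2
    have hbig := hvel (k + N)
    have htri := norm_sub_norm_le (u (tc (k + N)) (xc (k + N))) (u (tc (k + N)) (x₂' (k + N)))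
    linarith [abs_le.1 (abs_norm_sub_norm_le (u (tc (k + N)) (xc (k + N))) (u (tc (k + N)) (x₂' (k + N))))]

end Summit.NavierStokesRegularity.NavierStokesRegularity.Theorems.RecordZoomAncient.Birth

end
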